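import Summits.CriticalPhenomena.SAWScalingLimit.Theorems.SAWTotalPositivityBoundaryHarnackGadgetWeights
import Summits.CriticalPhenomena.SAWScalingLimit.Theorems.SAWTotalPositivityBoundaryHarnack

/-!
# `BoundaryHarnack ⇒` a uniform critical half-plane arch bound: assembly and the limit `M → ∞`

Route `SAWTotalPositivity`, item stmt-CriticalPhenomena-7120 (`BoundaryHarnack`), converse /
hardness direction, final part. Using the gadget `V = Λ_N ∪ corridor` and the two weight bounds
`x_c · Z_Λ(b',b) ≤ Z_V(t,b)` and `Z_V(t,b') ≤ x_c + x_c^m Z_Λ(g_R,b')` (file `…GadgetWeights`), we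
verify the hypotheses of `BoundaryHarnack` at `(Ω_V, 1, t, b, b', c)` — `b' ∼ b ∼ c`, interlacing
(automatic since `deg_V(b) = 2`), the two disjoint realisations — and let `M → ∞` with `N` fixed:

**`archBound_of_boundaryHarnack`**: `BoundaryHarnack → ∃ C < ∞, ∀ N ≥ 2, Z_{Λ_N}(b', b) ≤ C`
(same constant `C`), where `Λ_N = ([-N,N] × [0,N]) \ {(0,1)}`, `b' = (-1,0)`, `b = (0,0)`:
`Z_{Λ_N}(b',b) = x_c + x_c · A_N` with `A_N ↑` the critical weight of half-plane arches
`(-1,0) → (1,0)` around the bump `{(0,0),(0,1)}` — a uniform critical boundary-bubble bound on `ℤ²`,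
known on the hexagonal lattice (Duminil-Copin–Smirnov) and open on `ℤ²`. With
`boundaryHarnack_of_criticalBubbleBound` (`CriticalBubbleBound → BoundaryHarnack`,
file `SAWTotalPositivityBoundaryHarnack.lean`) the item is sandwiched between two open critical
two-point bounds. Everything proved. [folklore]
-/

noncomputable section

namespace Summit.CriticalPhenomena.SAWScalingLimit.Theorems.BoundaryHarnack.Negative

open Literature.Probability.LatticeModels Literature.Probability.RandomPlanarGeometry
open Literature.Probability.RandomPlanarGeometry.SAW Set Relation Filter Topology
open Summit.CriticalPhenomena.SAWScalingLimit.Theorems.BoundaryHarnack.Realisation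
open Summit.CriticalPhenomena.SAWScalingLimit.Theses.SAWTotalPositivity (BoundaryHarnack CriticalBubbleBound)
open scoped ENNReal

variable {N M : ℕ}

/-! ### The hypotheses of `BoundaryHarnack` at the gadget -/

/-- **Interlacing is automatic**: every SAW `t → b` of `V` enters `b` from `b'` or `c`
(`deg_V(b) = 2`), both of which lie on every SAW `b' → c`. [folklore] -/
theorem interlacing (hN : 2 ≤ N) (hM : 2 ≤ M)
    (P : DomainSAW (gadgetDomain N M) 1 ![-1, -1] ![0, 0])
    (Q : DomainSAW (gadgetDomain N M) 1 ![-1, 0] ![1, 0]) :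
    ∃ v, v ∈ P.walk.support ∧ v ∈ Q.walk.support := by
  set r := P.walk.reverse with hr
  have hlen : 0 < r.length := by
    rw [hr, SimpleGraph.Walk.length_reverse]
    rcases Nat.eq_zero_or_pos P.walk.length with h | h
    · exact absurd (SimpleGraph.Walk.eq_of_length_eq_zero h) (by decide)
    · exact h
  have hadj := r.adj_getVert_succ (i := 0) hlen
  rw [SimpleGraph.Walk.getVert_zero, adjV hN hM] at hadj
  have hz : r.getVert 1 ∈ P.walk.support := by
    have := r.getVert_mem_support 1
    rwa [hr, SimpleGraph.Walk.support_reverse, List.mem_reverse] at this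
  rcases neighbours_b hM hadj.2.2 hadj.1 with h | h
  · exact ⟨_, hz, by rw [h]; exact Q.walk.start_mem_support⟩
  · exact ⟨_, hz, by rw [h]; exact Q.walk.end_mem_support⟩

/-- Disjoint realisation of `(t b' | b c)`: the two edges. [folklore] -/
theorem realisable₁ (hN : 2 ≤ N) (hM : 2 ≤ M) :
    ∃ (P : DomainSAW (gadgetDomain N M) 1 ![-1, -1] ![-1, 0])
      (Q : DomainSAW (gadgetDomain N M) 1 ![0, 0] ![1, 0]),
      List.Disjoint P.walk.support Q.walk.support := by
  refine ⟨⟨SimpleGraph.Walk.cons (adj_t_b' hN hM) SimpleGraph.Walk.nil, by simp⟩,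
    ⟨SimpleGraph.Walk.cons (adj_b_c hN hM) SimpleGraph.Walk.nil, by simp⟩, ?_⟩
  simp only [SimpleGraph.Walk.support_cons, SimpleGraph.Walk.support_nil]
  intro a ha hb
  simp only [List.mem_cons, List.not_mem_nil, or_false] at ha hb
  rcases ha with rfl | rfl <;> rcases hb with h | h <;> exact absurd h (by decide)

/-- Lattice walks inside `T ⊆ V` give walks of `ℤ²[V]` with vertices in `T`. [folklore] -/
theorem exists_walk_of_rtg (hN : 2 ≤ N) (hM : 2 ≤ M) {T : Set (Site 2)} (hT : T ⊆ gadget N M)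
    {x y : Site 2} (hx : x ∈ T) (h : ReflTransGen (SiteStep T) x y) :
    ∃ p : (discreteDomainGraph (gadgetDomain N M) 1).Walk x y, ∀ w ∈ p.support, w ∈ T := by
  induction h with
  | refl => exact ⟨SimpleGraph.Walk.nil, fun w hw => by
      rw [SimpleGraph.Walk.support_nil, List.mem_singleton] at hw; exact hw ▸ hx⟩
  | @tail u w _ hs ih =>
    obtain ⟨p, hp⟩ := ih
    refine ⟨p.concat ((adjV hN hM).2 ⟨hs.1, hT hs.2.1, hT hs.2.2⟩), fun z hz => ?_⟩
    rw [SimpleGraph.Walk.support_concat, List.mem_append, List.mem_singleton] at hz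
    rcases hz with hz | rfl
    · exact hp z hz
    · exact hs.2.2

/-- Disjoint realisation of `(t c | b' b)`: `t → c` through the corridor and around the half-box
avoiding `b', b`, and the edge `b' b`. [folklore] -/
theorem realisable₂ (hN : 2 ≤ N) (hM : 2 ≤ M) :
    ∃ (P : DomainSAW (gadgetDomain N M) 1 ![-1, -1] ![1, 0])
      (Q : DomainSAW (gadgetDomain N M) 1 ![-1, 0] ![0, 0]),
      List.Disjoint P.walk.support Q.walk.support := by
  obtain ⟨p, hp⟩ := exists_walk_of_rtg hN hM (T := gadget N M \ {![-1, 0], ![0, 0]}) sdiff_subset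
    ⟨Or.inr (t_mem_corSet hM), by simp⟩ (rtg_t_to_c hN hM)
  refine ⟨⟨p.bypass, p.bypass_isPath⟩,
    ⟨SimpleGraph.Walk.cons (adj_b'_b hN hM) SimpleGraph.Walk.nil, by simp⟩, ?_⟩
  intro a ha hb
  have haT := hp a (p.support_bypass_subset_support ha)
  simp only [SimpleGraph.Walk.support_cons, SimpleGraph.Walk.support_nil, List.mem_cons,
    List.not_mem_nil, or_false] at hb
  exact haT.2 (by rcases hb with rfl | rfl <;> simp)

/-- **`BoundaryHarnack` applied to the gadget**: `Z_V(t,b) ≤ C · Z_V(t,b')`. [folklore] -/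
theorem harnack_at_gadget (hBH : BoundaryHarnack) :
    ∃ C : ℝ≥0∞, C ≠ ⊤ ∧ ∀ N M : ℕ, 2 ≤ N → 2 ≤ M →
      SAW.weight (gadgetDomain N M) 1 ![-1, -1] ![0, 0] univ ≤
        C * SAW.weight (gadgetDomain N M) 1 ![-1, -1] ![-1, 0] univ := by
  obtain ⟨C, hC, h⟩ := hBH
  refine ⟨C, hC, fun N M hN hM => ?_⟩
  exact h (gadgetDomain N M) 1 ![-1, -1] ![0, 0] ![-1, 0] ![1, 0] isBounded_realise
    (simplyConnectedSpace_realise hab_V) one_pos (adj_b'_b hN hM) (adj_b_c hN hM)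
    (interlacing hN hM) (realisable₁ hN hM) (realisable₂ hN hM)

/-! ### The limit `M → ∞` -/

/-- `Z_Λ(g_R, b') < ∞`. [folklore] -/
theorem weight_gR_ne_top (hN : 2 ≤ N) :
    SAW.weight (halfBoxDomain N) 1 ![-(N : ℤ), 0] ![-1, 0] univ ≠ ⊤ :=
  weight_univ_ne_top_of_isBounded isBounded_realise one_pos
    (by have := gR_mem_halfBox hN; rwa [← meshDomain_Λ hN] at this)

/-- **`BoundaryHarnack` forces a uniform critical half-plane arch bound.** If `BoundaryHarnack`
holds with constant `C`, then for every `N ≥ 2` the critical partition function of the notched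
half-box between the adjacent boundary sites `b' = (-1,0)`, `b = (0,0)` satisfies
`Z_{Λ_N}(b', b) ≤ C`; `Z_{Λ_N}(b',b) = x_c + x_c · A_N` with `A_N ↑` the critical weight of
half-plane arches of span 2 around a 2-site bump — a uniform boundary-bubble bound on `ℤ²` that is
open in print (known on the hexagonal lattice). Hence the item `BoundaryHarnack` is sandwiched:
`CriticalBubbleBound ⇒ BoundaryHarnack ⇒ (uniform arch bound)`. [folklore] -/
theorem archBound_of_boundaryHarnack (hBH : BoundaryHarnack) :
    ∃ C : ℝ≥0∞, C ≠ ⊤ ∧ ∀ N : ℕ, 2 ≤ N →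
      SAW.weight (halfBoxDomain N) 1 ![-1, 0] ![0, 0] univ ≤ C := by
  obtain ⟨C, hC, h⟩ := harnack_at_gadget hBH
  refine ⟨C, hC, fun N hN => ?_⟩
  set x : ℝ≥0∞ := ENNReal.ofReal criticalFugacity with hx
  set A := SAW.weight (halfBoxDomain N) 1 ![-1, 0] ![0, 0] univ with hA
  set K := SAW.weight (halfBoxDomain N) 1 ![-(N : ℤ), 0] ![-1, 0] univ with hK
  have hx0 : x ≠ 0 := (ENNReal.ofReal_pos.2 criticalFugacity_pos_lt_one'.1).ne'
  have hx1 : x < 1 := ENNReal.ofReal_lt_one.2 criticalFugacity_pos_lt_one'.2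
  have hKtop : K ≠ ⊤ := weight_gR_ne_top hN
  -- for every `M ≥ 2`: `x A ≤ C (x + x^(2M+N) K)`
  have key : ∀ M : ℕ, 2 ≤ M → x * A ≤ C * (x + x ^ (2 * M + N) * K) := fun M hM =>
    calc x * A ≤ SAW.weight (gadgetDomain N M) 1 ![-1, -1] ![0, 0] univ := weight_tb_ge hN hM
      _ ≤ C * SAW.weight (gadgetDomain N M) 1 ![-1, -1] ![-1, 0] univ := h N M hN hM
      _ ≤ C * (x + x ^ (2 * M + N) * K) := by gcongr; exact weight_tb'_le hN hM
  -- let `M → ∞`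
  have hlim : Tendsto (fun M : ℕ => C * (x + x ^ (2 * M + N) * K)) atTop (𝓝 (C * (x + 0 * K))) := by
    refine ENNReal.Tendsto.const_mul (tendsto_const_nhds.add (ENNReal.Tendsto.mul_const ?_ (Or.inr hKtop)))
      (Or.inr hC)
    have h2 : Tendsto (fun M : ℕ => (x ^ 2) ^ M) atTop (𝓝 0) :=
      ENNReal.tendsto_pow_atTop_nhds_zero_iff.2 (by
        calc x ^ 2 < 1 ^ 2 := by gcongr
          _ = 1 := one_pow 2)
    have h3 : Tendsto (fun M : ℕ => x ^ N * (x ^ 2) ^ M) atTop (𝓝 (x ^ N * 0)) :=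
      ENNReal.Tendsto.const_mul h2 (Or.inr (ENNReal.pow_ne_top ENNReal.ofReal_ne_top))
    rw [mul_zero] at h3
    refine h3.congr fun M => ?_
    rw [← pow_mul, ← pow_add, add_comm, mul_comm]
  rw [zero_mul, add_zero] at hlim
  have hle : x * A ≤ C * x := ge_of_tendsto hlim (eventually_atTop.2 ⟨2, key⟩)
  rw [mul_comm C x] at hle
  exact (ENNReal.mul_le_mul_iff_right hx0 ENNReal.ofReal_ne_top).1 hle

/-- **The sandwich.** The item `BoundaryHarnack` (stmt-CriticalPhenomena-7120) sits between two
critical two-point bounds on `ℤ²` that are both open in print: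
`CriticalBubbleBound ⇒ BoundaryHarnack ⇒ (uniform notched half-box arch bound)`. The first
implication is `boundaryHarnack_of_criticalBubbleBound` (one-step splitting at `b'`), the second is
`archBound_of_boundaryHarnack` (the corridor gadget). [folklore] -/
theorem boundaryHarnack_sandwich :
    (CriticalBubbleBound → BoundaryHarnack) ∧
      (BoundaryHarnack → ∃ C : ℝ≥0∞, C ≠ ⊤ ∧ ∀ N : ℕ, 2 ≤ N →
        SAW.weight (halfBoxDomain N) 1 ![-1, 0] ![0, 0] univ ≤ C) :=
  ⟨boundaryHarnack_of_criticalBubbleBound, archBound_of_boundaryHarnack⟩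

end Summit.CriticalPhenomena.SAWScalingLimit.Theorems.BoundaryHarnack.Negative
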